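import Summits.Ventures.YMGap.RobustBall.Defs
import Summits.Ventures.YMGap.Thresholds.OneLinkTiltStability
import HarnessLib

/-!
# RobustBall/Targets — statement skeletons for track Y2 (ROBUST-BALL): the single-link door targets U0–U3,
the tier-2 weighted door, the area-law interface U4–U5, the plaquette bridge and plaquette-member target, the T0.2
witnesses ((w1) `1×2` rectangles, (w2) adjoint density, (w3) parallel plaquette pairs), and the `SU(2)`, `d = 4` rows
(rb-theory, design v0.2/v0.3, 2026-08-22)

HONEST FRAMING: TARGET SHAPES (`Prop`s) only — each `…Target` is what a prover seat proves, by name; the one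
`theorem` (`oneLinkTransferTarget_holds`) records that U1 IS the tree's `OneLinkTiltStability.su_oneLink_transfer`.
Strong-coupling LATTICE statements only; nothing about the continuum limit or a Clay-sense mass gap. A ROW is a
`def … : Prop` naming its DOOR and its certified `(β⋆, ε)` (exact rational certificates: `HOME/rb/certs/rb_rows.json`,
two lineages); it becomes a theorem only when that door is on the tree. Owners (cell bus 2026-08-22): U0/U0′/U3/
U3-W/C-MGT(-W) on the torus — ds-2; the `ℤ^d` mirror (`MassGapOnBallZd` and its rows) — rb-p1's `RobustBall/MassGapOnBall.lean`
+ `RowsSU2.lean` (not restated here); U4 bridges, the robust SLAB door and the U5 assembly — rb-p2 (`RobustSlabLaw` +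
successors; door and assembly proved in folder 2026-08-22); the plaquette bridge — ds-4.

UNITS. Torus targets take the TREE coupling `β` (`SU(2)`: `β = β_W/2`); the slab interface `SlabCovarianceOnBall` takes
the 'T HOOFT coupling `βt` like rb-p2's `slabLawW` (`SU(2)`: `βt = β_W/4`) and the assembly writes `β = N * βt`.
-/

noncomputable section

open MeasureTheory ProbabilityTheory Finset Function
open scoped NNReal
open Literature.Probability.LatticeModels Literature.Probability.LatticeModels.DobrushinMetric
open Literature.MathematicalPhysics.QuantumLattice hiding torusNorm
open Literature.MathematicalPhysics.QuantumFieldTheory hiding ZdEdge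
open Literature.MathematicalPhysics.QuantumFieldTheory.Balaban1983to89.StrongCouplingTorusWindow
  (wilsonPlaqWeight tField tInfluence)
open Literature.MathematicalPhysics.QuantumFieldTheory.Balaban1983to89.StrongCouplingDobrushinWindow
  (OneLinkKRModulus)

namespace Summit.Ventures.YMGap.RobustBall

variable {d L N : ℕ} [NeZero L]

/-! ## PART 2 — statement skeletons for the provers (TARGET shapes as `Prop`s; DESIGN §5, §8) -/

/-! ### U0–U3: the single-link door on the torus (rb-p1; U1/U2 ds-4) -/

/-- The local reweighting function of the one-link law at `e` under boundary condition `η`: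
`h_{W,e,η}(g) = ∑_{X ∋ e} W_X(η^{e←g})` (polymers not containing `e` only shift the energy by a constant). [folklore] -/
def localTilt (W : Perturbation d L N) (e : Edge d L) (η : GaugeConfig d L (SUN N)) (g : SUN N) : ℝ :=
  ∑ X ∈ polymersThroughEdge e, W.act X (Function.update η e g)

/-- **U0 (rb-p1)**: the one-link law of the perturbed torus specification is the 't Hooft law `ν_{B(η)}`
re-weighted by `exp(−h_{W,e,η})` (twin of `siteLaw_torusWilson_thooft` / rb-p1's `siteLaw_perturbedYM_thooft`). [folklore] -/
def SiteLawTarget (N d : ℕ) : Prop :=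
  ∀ (L : ℕ) [NeZero L], 1 < L → 1 ≤ N → ∀ (β : ℝ) (W : Perturbation d L N) (e : Edge d L)
    (η : GaugeConfig d L (SUN N)),
    siteLaw (perturbedTorusSpec W β) e η =
      ((haarProbability (SUN N)).tilted
        fun g => (N : ℝ) * ((g : Matrix (Fin N) (Fin N) ℂ) * tField β e η).trace.re).tilted
        fun g => -localTilt W e η g

/-- **U0' (rb-p1)**: the loads control the reweighting function: oscillation `≤ a(e)`, Lipschitz in `g`
`≤ ℓ_s(e)`, and `sup_g |h_ω(g) − h_η(g)| ≤ ℓ(e,y) · d_F(ω_y, η_y)` for `ω = η` off `y ≠ e`. [folklore] -/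
def LocalTiltLoadsTarget (N d : ℕ) : Prop :=
  ∀ (L : ℕ) [NeZero L] (W : Perturbation d L N) (w : LoadWitness W) (e : Edge d L),
    (∀ η (g g' : SUN N), localTilt W e η g - localTilt W e η g' ≤ w.oscLoad 0 e) ∧
    (∀ η (g g' : SUN N), |localTilt W e η g - localTilt W e η g'| ≤ w.selfLipLoad 0 e * suFrobDist g g') ∧
    (∀ (y : Edge d L), y ≠ e → ∀ (ω η : GaugeConfig d L (SUN N)), (∀ z, z ≠ y → ω z = η z) →
      ∀ g, |localTilt W e ω g - localTilt W e η g| ≤ w.crossLip 0 e y * suFrobDist (ω y) (η y))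

/-- **U1 (ds-4, R146) — robust transfer of an arbitrary one-link KR modulus under a bounded Lipschitz
re-weighting**: `K ↦ K · e^{δ} · (1 + 2√N · ℓ)` for re-weightings `h` with oscillation `≤ δ` and
`suFrobDist`-Lipschitz constant `0 ≤ ℓ`. PROVED: `oneLinkTransferTarget_holds` (= `su_oneLink_transfer`). [folklore] -/
def OneLinkTransferTarget (N : ℕ) (R K δ ℓ : ℝ) : Prop :=
  0 ≤ ℓ → OneLinkKRModulus N R K →
  ∀ (B B' : Matrix (Fin N) (Fin N) ℂ), matrixOpNorm B ≤ R → matrixOpNorm B' ≤ R →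
    ∀ (h : SUN N → ℝ), Measurable h → (∀ g g', h g - h g' ≤ δ) →
      (∀ g g', |h g - h g'| ≤ ℓ * suFrobDist g g') →
    ∀ (φ : SUN N → ℝ) (Lφ : ℝ), Measurable φ → (∃ M, ∀ s, |φ s| ≤ M) → 0 ≤ Lφ →
      (∀ a b, |φ a - φ b| ≤ Lφ * suFrobDist a b) →
      |∫ s, φ s ∂(((haarProbability (SUN N)).tilted
            fun g => (N : ℝ) * ((g : Matrix (Fin N) (Fin N) ℂ) * B).trace.re).tilted fun g => -h g) -
        ∫ s, φ s ∂(((haarProbability (SUN N)).tilted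
            fun g => (N : ℝ) * ((g : Matrix (Fin N) (Fin N) ℂ) * B').trace.re).tilted fun g => -h g)| ≤
        K * Real.exp δ * (1 + 2 * Real.sqrt N * ℓ) * Lφ * frobNorm (B - B')

/-- U1 holds: ds-4's `Summit.Ventures.YMGap.OneLinkTiltStability.su_oneLink_transfer`
(Thresholds/OneLinkTiltStability.lean). [folklore] -/
theorem oneLinkTransferTarget_holds (N : ℕ) (R K δ ℓ : ℝ) : OneLinkTransferTarget N R K δ ℓ :=
  fun hℓ hK B B' hB hB' h hh hδ hhℓ φ Lφ hφ hφb hL hφL =>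
    OneLinkTiltStability.su_oneLink_transfer hℓ hK B B' hB hB' h hh hδ hhℓ φ Lφ hφ hφb hL hφL

/-- **U2 — the CROSS leg, Grüss form**: two re-weightings of the same base probability measure differ on an
`L`-Lipschitz `φ` by at most `√N · L · sup|h − h'|`. PROVED: `crossLegTarget_holds`
(= ds-4's `su_abs_integral_tilt_sub_tilt_le`). The sharper variance form `√(c_P e^{a})` (engine-2's
`OneLinkHolleyStroock`) replaces `√N` where a Lipschitz-Poincaré constant is certified. [folklore] -/
def CrossLegTarget (N : ℕ) : Prop :=
  ∀ (μ : Measure (SUN N)) [IsProbabilityMeasure μ] (h h' : SUN N → ℝ) (s : ℝ),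
    Measurable h → Measurable h' → (∃ M, ∀ g, |h g| ≤ M) → (∃ M, ∀ g, |h' g| ≤ M) →
    (∀ g, |h g - h' g| ≤ s) →
    ∀ (φ : SUN N → ℝ) (Lφ : ℝ), Measurable φ → (∃ M, ∀ g, |φ g| ≤ M) → 0 ≤ Lφ →
      (∀ a b, |φ a - φ b| ≤ Lφ * suFrobDist a b) →
      |∫ g, φ g ∂(μ.tilted fun g => -h g) - ∫ g, φ g ∂(μ.tilted fun g => -h' g)| ≤
        Real.sqrt N * Lφ * s

/-- The expected tier-1 row-sum function of the single-link / slab doors (DESIGN §5 U3, §6):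
`ρ = max( e^{ε₀}(1 + 2√N ε₁)·c_W , e^{ε₀} c_W + √N·ε₁ )` (Grüss cross coefficient; the row sum is affine in
the self- and cross-Lipschitz loads at the SAME link, whose sum is `≤ ε₁`, so the worst case is one of the two
vertices). `c_W` = the door's WILSON Dobrushin constant at `β⋆` (single link `K(|β|/N)6(d−1)`, slab one third). [folklore] -/
def rhoFR (N : ℕ) (cW ε₀ ε₁ : ℝ) : ℝ :=
  max (Real.exp ε₀ * (1 + 2 * Real.sqrt N * ε₁) * cW) (Real.exp ε₀ * cW + Real.sqrt N * ε₁)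

/-- **U3 (rb-p1) — the robust torus door from a one-link modulus**: a modulus `OneLinkKRModulus N R K` on the
radius `R ≥ (|β|/N)·2(d−1)` gives `RobustTorusDoor` with row sums `rhoFR N (K·(|β|/N)·6(d−1)) ε₀ ε₁`
(Wilson constant of `isKRContraction_torusWilson` + `sum_tInfluence_le`; U1 on the black-box leg, U2 on
the cross leg). [folklore] -/
def RobustTorusDoorTarget (N d : ℕ) (β ε₀ ε₁ R K : ℝ) (r : ℕ) : Prop :=
  0 ≤ K → |β| / N * (2 * ((d : ℝ) - 1)) ≤ R → OneLinkKRModulus N R K → 0 ≤ ε₀ → 0 ≤ ε₁ →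
    RobustTorusDoor N d β ε₀ ε₁ r (rhoFR N (K * (|β| / N) * (6 * ((d : ℝ) - 1))) ε₀ ε₁)

/-- **U3-W — the tier-2 torus door from a one-link modulus**: weighted rows `≤ rhoFR N (e^{κ}·K(|β|/N)6(d−1)) ε₀ ε₁`
with `t = κ` (plaquette neighbours sit at distance `≤ 1`, hence the factor `e^{κ}` on the Wilson constant). [folklore] -/
def RobustTorusDoorWTarget (N d : ℕ) (β κ ε₀ ε₁ R K : ℝ) : Prop :=
  0 ≤ K → 0 ≤ κ → |β| / N * (2 * ((d : ℝ) - 1)) ≤ R → OneLinkKRModulus N R K → 0 ≤ ε₀ → 0 ≤ ε₁ →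
    RobustTorusDoorW N d β κ ε₀ ε₁ κ
      (rhoFR N (Real.exp κ * K * (|β| / N) * (6 * ((d : ℝ) - 1))) ε₀ ε₁)

/-- **C-MGT (rb-p1) — clustering from the tier-1 door**: a robust door with `ρ < 1` gives torus-uniform
clustering at rate `−log ρ / (r ⊔ 1)` per lattice unit (`abs_covariance_le_of_isKRContraction` with the profile
`⌊dist/(r ⊔ 1)⌋` + the Gibbs property of `W.perturbedMeasure` for `perturbedTorusSpec W β`); the constant
`8N = 2·(2√N)²` is the tree's single-coupling shape and is INDICATIVE — the prover fixes it. [folklore] -/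
def ClusteringFromDoorTarget (N d : ℕ) (β ε₀ ε₁ ρ : ℝ) (r : ℕ) : Prop :=
  RobustTorusDoor N d β ε₀ ε₁ r ρ → 0 < ρ → ρ < 1 →
    TorusClusteringOnBall N d β ε₀ ε₁ r (8 * N) (-Real.log ρ / max r 1)

/-- **C-MGT-W — clustering from the tier-2 door**: weighted rows `≤ ρ < 1` at weight `t ≥ 0` give clustering at
rate `t` per lattice unit (`abs_covariance_le_of_isKRContraction_exp_dist` with `d e y = ‖e.1 − y.1‖_∞`,
profile `dist(·, Δ_g)`; the engine's constant is `2R² = 8N` flat — the weighted condition absorbs the geometric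
series — INDICATIVE, the prover fixes it). [folklore] -/
def ClusteringFromWeightedDoorTarget (N d : ℕ) (β κ ε₀ ε₁ t ρ : ℝ) : Prop :=
  RobustTorusDoorW N d β κ ε₀ ε₁ t ρ → 0 ≤ t → 0 ≤ ρ → ρ < 1 →
    TorusClusteringOnBallW N d β κ ε₀ ε₁ (8 * N) t

/-! ### U4: the area-law sub-ball from carrier clauses (rb-theory / rb-p2) -/

/-- **Centre-slab invariance is derived, not assumed**: vertical dependence diameter `m < L` and the carrier's
per-activity gauge invariance give `IsSlabLocal m W` (rotate slab `t` by central `z` = a gauge transformation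
times the inverse rotation of a far slab `t' ∉` the activity's window). [folklore] -/
def IsSlabLocalOfVertRangeTarget (N d m : ℕ) : Prop :=
  ∀ (L : ℕ) [NeZero L] (W : Perturbation d L N), m < L → HasVertRange m W → IsSlabLocal m W

/-! ### U5: rb-p2's slab covariance interface (VERBATIM) and the area-law assembly -/

/-- **U5 input — uniform perturbed-SLAB covariance bound** (rb-p2 RB-P2-AREALAW-DESIGN §6, the hypothesis
`hcov` of `robust_slab_criterion`, verbatim): for every torus `L`, every member of the tier-1 ball which is
slab-local with vertical diameter `m`, every direction `v`, height `t` and conditioning `rr` of the off-slab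
links, the entries of two vertical links `Q x`, `(Q y)⁻¹` of the slab have covariance `≤ C₁ e^{−C₂ dist(x,y)}`
under the perturbed slab law `slabLawW v t βt W.total rr` ('t Hooft `βt`, torus dimension `n + 1`). Delivered by
the robust SLAB door (single-link door with the slab staple: one third of the Wilson incidences, loads `a`,
`Λ_slab ≤ Λ`). [folklore] -/
def SlabCovarianceOnBall (N n : ℕ) (βt ε₀ ε₁ : ℝ) (r m : ℕ) (C₁ C₂ : ℝ) : Prop :=
  ∀ (L : ℕ) [NeZero L] (W : Perturbation (n + 1) L N), W ∈ ClusterDomainFR ε₀ ε₁ r → IsSlabLocal m W →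
    ∀ (v : Fin (n + 1)) (t : ZMod L) (rr : {e : Edge (n + 1) L // ¬ DurhuusFrohlich.IsSlab v t e} → SUN N)
      (x y : Site n L) (i j k l : Fin N) (φ ψ : ℂ → ℝ),
      (φ = Complex.re ∨ φ = Complex.im) → (ψ = Complex.re ∨ ψ = Complex.im) →
        |cov[fun Q => φ ((Q x : Matrix (Fin N) (Fin N) ℂ) i j),
            fun Q => ψ ((((Q y)⁻¹ : SUN N) : Matrix (Fin N) (Fin N) ℂ) k l); slabLawW v t βt W.total rr]| ≤
          C₁ * Real.exp (-C₂ * torusGraphDist x y)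

/-- **U5 assembly (rb-p2, PROVED as `robust_slab_criterion_quasiLocal` modulo this packaging and the bridge
`IsSlabLocal m W → (hloc, hWc)`)**: the slab covariance bound on the ball gives the area law on the ball at tree
coupling `N βt` with rate `C₂/(2m)` and constant `max N e^{(C₂/2m) M₀²}` (no perimeter factor needed; `2 ≤ N` for a
non-trivial centre, `1 ≤ m`). [folklore] -/
def AreaLawFromSlabCovarianceTarget (N n : ℕ) (βt ε₀ ε₁ : ℝ) (r m : ℕ) : Prop :=
  ∀ C₁ C₂ : ℝ, 0 < C₂ → 2 ≤ N → 1 ≤ m → SlabCovarianceOnBall N n βt ε₀ ε₁ r m C₁ C₂ →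
    AreaLawOnBall N (n + 1) (N * βt) ε₀ ε₁ r m

/-! ### The plaquette-rung bridge (ds-4 S6 (B)) -/

/-- A plaquette-action member IS a plaquette-weight specification: `perturbedTorusSpec W β = torusWeightSpec
(v_β · e^{−f})`, so ds-4's star-window machinery (Lemma G with `c ↦ c_eff`) applies verbatim. [folklore] -/
def PlaquetteBridgeTarget (N d : ℕ) : Prop :=
  ∀ (L : ℕ) [NeZero L] (f : SUN N → ℝ) (W : Perturbation d L N) (β : ℝ), IsPlaquetteAction f W →
    perturbedTorusSpec W β = torusWeightSpec fun g => wilsonPlaqWeight N β g * Real.exp (-f g)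


/-! ### The plaquette rung as MEMBERS of the ball: generic membership with computed loads, and witness (w2) -/

/-- PLAQUETTE-MEMBER TARGET (rb-theory [G7]; prover ds-4 / rb-p1): every continuous class function `f` on `SU(N)` with
oscillation `≤ a₀` and Frobenius-Lipschitz constant `≤ λ` defines a plaquette-action member `W` (`W.total = ∑_q f(U_q)`,
each activity supported on one plaquette) lying in the tier-1 ball with the COMPUTED per-link loads: oscillation load
`2(d−1)·a₀` (a link lies in `2(d−1)` plaquettes), Lipschitz load `ℓ_s + Λ ≤ 2(d−1)λ + 3·2(d−1)λ = 8(d−1)λ`, range `1`,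
vertical window `1`, centre-slab invariant. [folklore] -/
def PlaquetteMemberTarget (N d : ℕ) : Prop :=
  ∀ (f : SUN N → ℝ) (a₀ lam : ℝ), Continuous f → (∀ g h : SUN N, f (h * g * h⁻¹) = f g) →
    (∀ x y, f x - f y ≤ a₀) → (∀ x y, |f x - f y| ≤ lam * suFrobDist x y) →
    ∀ (L : ℕ) [NeZero L], 3 ≤ L → ∃ W : Perturbation d L N,
      IsPlaquetteAction f W ∧ IsPlaquetteLocal W ∧
        W ∈ ClusterDomainFR (2 * ((d : ℝ) - 1) * a₀) (8 * ((d : ℝ) - 1) * lam) 1 ∧ HasVertRange 1 W ∧ IsSlabLocal 1 W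

/-- Witness (w2), the ADJOINT-PLAQUETTE density `f_t(h) = t · (|tr h|² − 1)/(N² − 1)` (`= t · Re χ_adj(h)/dim adj`;
a real class function, inversion-invariant). [folklore] -/
def adjointDensity (N : ℕ) (t : ℝ) (h : SUN N) : ℝ :=
  t * (Complex.normSq (h : Matrix (Fin N) (Fin N) ℂ).trace - 1) / ((N : ℝ) ^ 2 - 1)

/-- ADJOINT LOADS TARGET (w2): `f_t` is continuous, a class function, has oscillation `≤ |t|·N²/(N² − 1)` (`|tr h|² ∈
[0, N²]`) and Frobenius-Lipschitz constant `≤ 2N√N·|t|/(N² − 1)` (`||tr h|² − |tr h′|²| ≤ (|tr h| + |tr h′|)·|tr(h − h′)|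
≤ 2N·√N‖h − h′‖_F`); with `PlaquetteMemberTarget` this puts the mixed fundamental–adjoint actions in the ball with
loads `(2(d−1)|t|N²/(N²−1), 16(d−1)N√N|t|/(N²−1), 1)`. Stated for `2 ≤ N`. [folklore] -/
def AdjointLoadsTarget (N : ℕ) : Prop :=
  2 ≤ N → ∀ t : ℝ, Continuous (adjointDensity N t) ∧ (∀ g h : SUN N, adjointDensity N t (h * g * h⁻¹) = adjointDensity N t g) ∧
    (∀ x y, adjointDensity N t x - adjointDensity N t y ≤ |t| * (N : ℝ) ^ 2 / ((N : ℝ) ^ 2 - 1)) ∧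
    (∀ x y, |adjointDensity N t x - adjointDensity N t y| ≤
      2 * (N : ℝ) * Real.sqrt N * |t| / ((N : ℝ) ^ 2 - 1) * suFrobDist x y)

/-! ### T0.2 witnesses: non-plaquette members with computed loads -/

/-- The `1×2`-RECTANGLE activity density based at `x`, short side along `i`, long side along `j`:
`τ · (1 − Re tr(U_∂r)/N)` (values in `[0, 2|τ|]`, Frobenius-Lipschitz `≤ |τ|/√N` in each of its 6 links). [folklore] -/
def rectangleActivity (N : ℕ) (τ : ℝ) (x : Site d L) (i j : Fin d) (U : GaugeConfig d L (SUN N)) : ℝ :=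
  τ * (1 - ((rectangleHolonomy U x i j 1 2 : SUN N) : Matrix (Fin N) (Fin N) ℂ).trace.re / N)

/-- **Witness (w1)**: the `1×2`-rectangle action `τ ∑_{r} (1 − Re tr U_∂r/N)` (all based rectangles, both
orientations; `6(d−1)` of them through each link) is a member of the tier-1 ball with range `2`, oscillation load
`12(d−1)|τ|`, Lipschitz load `36(d−1)|τ|/√N` (`d = 4`, `N = 2`: `36|τ|`, `54√2|τ|`), and is slab-local with
vertical diameter `2`. [folklore] -/
def RectangleWitnessTarget (N d : ℕ) : Prop :=
  ∀ (τ : ℝ) (L : ℕ) [NeZero L], 3 ≤ L → ∃ W : Perturbation d L N,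
    (∀ U, W.total U =
        ∑ x : Site d L, ∑ i : Fin d, ∑ j : Fin d, if i = j then 0 else rectangleActivity N τ x i j U) ∧
      W ∈ ClusterDomainFR (12 * ((d : ℝ) - 1) * |τ|) (36 * ((d : ℝ) - 1) * |τ| / Real.sqrt N) 2 ∧
      HasVertRange 2 W ∧ IsSlabLocal 2 W

/-- Witness (w3), a genuinely NON-LOOP member: the PARALLEL-PLAQUETTE PRODUCT activity
`τ · (Re tr U_{p}/N) · (Re tr U_{p + e_k}/N)` for the plaquette `p = (x; i, j)` and its translate by the unit vector
`e_k` (`k ≠ i, j`; polymer = the 8 links of the two plaquettes, sup-diameter 1, range ≤ 2). [folklore] -/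
def parallelPairActivity (N : ℕ) (τ : ℝ) (x : Site d L) (i j k : Fin d) (U : GaugeConfig d L (SUN N)) : ℝ :=
  τ * (((plaquetteHolonomy U x i j : SUN N) : Matrix (Fin N) (Fin N) ℂ).trace.re / N) *
    (((plaquetteHolonomy U (x + Pi.single k 1) i j : SUN N) : Matrix (Fin N) (Fin N) ℂ).trace.re / N)

/-- PARALLEL-PAIR WITNESS TARGET (w3): the sum of `parallelPairActivity N τ x i j k` over sites and ordered triples of
distinct directions is a member of the tier-1 ball with COMPUTED loads — per link: `4(d−1)(d−2)` pair-polymers through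
it (`2(d−1)` plaquettes containing the link × `(d−2)` transverse directions × the link sitting in either member), each of
oscillation `≤ 2|τ|` and one-link Lipschitz constant `≤ |τ|/√N` (`|Re tr(A g C) − Re tr(A g′ C)| ≤ √N‖g − g′‖_F` for
unitary `A, C`; a link occurs once in exactly one of the two holonomies), `7` partner links each: loads
`a ≤ 8(d−1)(d−2)|τ|`, `ℓ_s + Λ ≤ (1 + 7)·4(d−1)(d−2)|τ|/√N = 32(d−1)(d−2)|τ|/√N`, range `2`, vertical window `2`
(`d = 4`, `N = 2`: `48|τ|`, `96√2|τ|`). [folklore] -/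
def ParallelPairWitnessTarget (N d : ℕ) : Prop :=
  ∀ (τ : ℝ) (L : ℕ) [NeZero L], 3 ≤ L → ∃ W : Perturbation d L N,
    (∀ U, W.total U = ∑ x : Site d L, ∑ i : Fin d, ∑ j : Fin d, ∑ k : Fin d,
        if i < j ∧ k ≠ i ∧ k ≠ j then parallelPairActivity N τ x i j k U else 0) ∧
      W ∈ ClusterDomainFR (8 * ((d : ℝ) - 1) * ((d : ℝ) - 2) * |τ|)
          (32 * ((d : ℝ) - 1) * ((d : ℝ) - 2) * |τ| / Real.sqrt N) 2 ∧
      HasVertRange 2 W ∧ IsSlabLocal 2 W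

/-! ### Rows (SU(2), d = 4; numbers CERTIFIED by exact rational arithmetic — HOME/rb/certs, rb-ref LINEAGE-R —
each row names its DOOR; a row is a theorem only when that door is on the tree) -/

/-- AREA-LAW row, QUARTER slab door (the tree's quarter modulus `OneLinkKRModulusSU2 β_W (1/4)` =
`OneLinkKRModulus 2 (3β_W/2) 1`, kernel for `β_W ≤ 2/3` in `Thresholds/QuarterModulus*`, transferred by U1; slab
Wilson constant `(3/2)β_W`): `β⋆_W = 1/3` (tree `β = 1/6`), `ε = 159/1000` (`ε₀ = 2ε`, `ε₁ = ε`), range 2, vertical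
diameter 2; `rhoFR 2 (1/2) (159/500) (159/1000) < 1` certified (HOME/rb/certs/rb_rows.json, column QAL). [folklore] -/
def RowAreaLawSU2OneThirdQuarter : Prop :=
  AreaLawOnBall 2 4 (1 / 6) (159 / 500) (159 / 1000) 2 2

/-- AREA-LAW row, VARIANCE slab door (hypothesis-free pair `(c, v) = (2/3, 8/3)`, `ρ = 2β_W e^{2ε} + √(2/3) ε e^{ε}`):
`β⋆_W = 1/3`, `ε = 27/200`. [folklore] -/
def RowAreaLawSU2OneThird : Prop :=
  AreaLawOnBall 2 4 (1 / 6) (27 / 100) (27 / 200) 2 2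

/-- CLUSTERING row (torus), QUARTER single-link door (`OneLinkKRModulus 2 (3β_W/2) 1`, Wilson constant `(9/2)β_W`):
`β⋆_W = 1/8` (tree `β = 1/16`), `ε = 13/100`, range 2 (column Qgap). [folklore] -/
def RowClusteringSU2OneEighthQuarter : Prop :=
  ∃ A m : ℝ, 0 < m ∧ TorusClusteringOnBall 2 4 (1 / 16) (13 / 50) (13 / 100) 2 A m

/-- CLUSTERING row (torus), VARIANCE single-link door (`ρ = 6β_W e^{2ε} + √(2/3) ε e^{ε}`, hypothesis-free):
`β⋆_W = 1/8`, `ε = 97/1000` (rb-ref RB-11: `ε = 1/8` is NOT certifiable on this door). [folklore] -/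
def RowClusteringSU2OneEighth : Prop :=
  ∃ A m : ℝ, 0 < m ∧ TorusClusteringOnBall 2 4 (1 / 16) (97 / 500) (97 / 1000) 2 A m

/-! ### v0.3.1 APPEND — member / witness targets under the landed ball's SITE-INCIDENCE convention

p1 (g6) finding 2026-08-22T20:29Z: in the landed `Defs`, `polymersThroughEdge e` is every site set `X` with
`e ∈ polymerEdges 1 X`, i.e. containing the base site `e.1` (`mem_polymerEdges_iff`, `blockCorner_one`), so the
cross-Lipschitz load charges a polymer to EVERY link based at one of its sites, read or not (SITE INCIDENCE). The
gate's append-only rule keeps that convention (rb-theory ruling 20:54Z): the ball is internally consistent and at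
most `×d` smaller in the Lipschitz load than the reads-incidence ball; oscillation and self-Lipschitz loads are
unaffected (a witness puts `osc X e = lip X e = 0` where `W_X` ignores `e`). The three targets below restate
`PlaquetteMemberTarget` / `RectangleWitnessTarget` / `ParallelPairWitnessTarget` with the site-incidence Lipschitz
loads (one polymer per term, code = base-site set of the term's links: 3 sites for a plaquette, 5 for a based `1×2`
rectangle, 6 for a parallel plaquette pair; every term is charged all its read links at every link based in its
code): `6d(d−1)·λ`, `30d(d−1)·|τ|/√N`, `24d(d−1)(d−2)·|τ|/√N` (at `d = 4`: `72λ`, `360|τ|/√N`, `576|τ|/√N` versus the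
reads-incidence `24λ`, `108`, `192` of the v0.2 targets, which remain the statements for the reads-incidence upgrade
ball `RobustBall/FineBall.lean` and are NOT provable for the landed ball). -/

/-- PLAQUETTE-CLASS-FUNCTION MEMBER, site incidence (supersedes `PlaquetteMemberTarget` for the landed ball):
loads `a ≤ 2(d−1)a₀`, `ℓ_s + Λ ≤ 6d(d−1)λ`, range `1`, vertical window `1`. [folklore] -/
def PlaquetteMemberTargetC (N d : ℕ) : Prop :=
  ∀ (f : SUN N → ℝ) (a₀ lam : ℝ), Continuous f → (∀ g h : SUN N, f (h * g * h⁻¹) = f g) →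
    (∀ x y, f x - f y ≤ a₀) → (∀ x y, |f x - f y| ≤ lam * suFrobDist x y) →
    ∀ (L : ℕ) [NeZero L], 3 ≤ L → ∃ W : Perturbation d L N,
      IsPlaquetteAction f W ∧ IsPlaquetteLocal W ∧
        W ∈ ClusterDomainFR (2 * ((d : ℝ) - 1) * a₀) (6 * (d : ℝ) * ((d : ℝ) - 1) * lam) 1 ∧
        HasVertRange 1 W ∧ IsSlabLocal 1 W

/-- RECTANGLE WITNESS (w1), site incidence (supersedes `RectangleWitnessTarget` for the landed ball): loads
`a ≤ 12(d−1)|τ|`, `ℓ_s + Λ ≤ 30d(d−1)|τ|/√N`, range `2`, vertical window `2`. [folklore] -/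
def RectangleWitnessTargetC (N d : ℕ) : Prop :=
  ∀ (τ : ℝ) (L : ℕ) [NeZero L], 3 ≤ L → ∃ W : Perturbation d L N,
    (∀ U, W.total U =
        ∑ x : Site d L, ∑ i : Fin d, ∑ j : Fin d, if i = j then 0 else rectangleActivity N τ x i j U) ∧
      W ∈ ClusterDomainFR (12 * ((d : ℝ) - 1) * |τ|) (30 * (d : ℝ) * ((d : ℝ) - 1) * |τ| / Real.sqrt N) 2 ∧
      HasVertRange 2 W ∧ IsSlabLocal 2 W

/-- PARALLEL-PAIR WITNESS (w3), site incidence (supersedes `ParallelPairWitnessTarget` for the landed ball):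
loads `a ≤ 8(d−1)(d−2)|τ|`, `ℓ_s + Λ ≤ 24d(d−1)(d−2)|τ|/√N`, range `2`, vertical window `2`. [folklore] -/
def ParallelPairWitnessTargetC (N d : ℕ) : Prop :=
  ∀ (τ : ℝ) (L : ℕ) [NeZero L], 3 ≤ L → ∃ W : Perturbation d L N,
    (∀ U, W.total U = ∑ x : Site d L, ∑ i : Fin d, ∑ j : Fin d, ∑ k : Fin d,
        if i < j ∧ k ≠ i ∧ k ≠ j then parallelPairActivity N τ x i j k U else 0) ∧
      W ∈ ClusterDomainFR (8 * ((d : ℝ) - 1) * ((d : ℝ) - 2) * |τ|)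
          (24 * (d : ℝ) * ((d : ℝ) - 1) * ((d : ℝ) - 2) * |τ| / Real.sqrt N) 2 ∧
      HasVertRange 2 W ∧ IsSlabLocal 2 W

end Summit.Ventures.YMGap.RobustBall

end
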